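import Mathlib
import Summits.ValiantsHypothesis.ValiantsHypothesis.Theorems.KPlusLogSqLawLiftingLaguerreWindowEuler

/-!
# Two-sided Descartes–Laguerre rule on an interval, part 3: base case and the single-term step

HONEST FRAMING.  Helper file toward the lifting crux `WeakLifting` (stmt-ValiantsHypothesis-19561; aside `Lifting`
stmt-ValiantsHypothesis-19772, registered stub `stub_liftThin`) of route `KPlusLogSqLaw` (cell `pub-symmetroid`, seat
val-sym-lift-p1 g8, 2026-08-27).  Elementary real analysis about ONE real function on an interval `(a, b)`, `0 < a < b`; nothing
here asserts `WeakLifting`, `TropicalB`, Conjecture B, `MatrixDescartes` (stmt-ValiantsHypothesis-18050) or anything about VP ≠ VNP.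

THIS FILE: two cases of the Descartes induction of part 4 that need no induction hypothesis — no window term
(`card_le_signVar_window_base`: `Var(σ_L·L, σ_H·H) ≤ 1`, one Euler step at `k = e + 1` leaves a zero-free function), and a single
window term whose sign agrees with the low tail (`card_le_signVar_window_single`: if the high tail opposes, one Euler step at the
window exponent leaves a zero-free function; otherwise `F` itself is zero-free).  No `def`.
[folklore] (Laguerre's method; quantitative one-variable Descartes theory).
-/

set_option linter.dupNamespace false
set_option autoImplicit false

namespace Summit.ValiantsHypothesis.ValiantsHypothesis.Theorems.KPlusLogSqLaw.LocalDescartes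

open Set Finset
open scoped BigOperators
open Literature.Algebra.Polynomial (signVar signVarAux)
open Literature.Computability.AlgebraicComplexity.BD17 (signVar_cons_cons_of_ne_zero)

/-- **Base of the induction (no window term).**  For `F = σ_L·L + σ_H·H` with admissible tails and `e + 1 < N`: at most
`Var(σ_L·L(c), σ_H·H(c))` zeros in `(a,b)`. [folklore] -/
theorem card_le_signVar_window_base (a b : ℝ) (ha : 0 < a) (hab : a < b)
    (e N : ℤ) (σL σH : ℝ) (L H : List (ℝ × ℤ × ℤ)) (heN : e + 1 < N)
    (hL : ∀ t ∈ L, 0 ≤ t.1 ∧ t.2.1 + t.2.2 ≤ e ∧ t.2.2 ≤ 0) (hH : ∀ t ∈ H, 0 ≤ t.1 ∧ N ≤ t.2.1 ∧ t.2.2 ≤ 0)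
    (Z : Finset ℝ)
    (hZ : ∀ z ∈ Z, z ∈ Ioo a b ∧
      σL * (L.map (fun t : ℝ × ℤ × ℤ => t.1 * (z ^ t.2.1 * (z - a) ^ t.2.2))).sum
        + (([] : List (ℤ × ℝ)).map (fun p : ℤ × ℝ => p.2 * z ^ p.1)).sum
        + σH * (H.map (fun t : ℝ × ℤ × ℤ => t.1 * (z ^ t.2.1 * (b - z) ^ t.2.2))).sum = 0)
    (hwit : ∃ x ∈ Ioo a b,
      σL * (L.map (fun t : ℝ × ℤ × ℤ => t.1 * (x ^ t.2.1 * (x - a) ^ t.2.2))).sum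
        + (([] : List (ℤ × ℝ)).map (fun p : ℤ × ℝ => p.2 * x ^ p.1)).sum
        + σH * (H.map (fun t : ℝ × ℤ × ℤ => t.1 * (x ^ t.2.1 * (b - x) ^ t.2.2))).sum ≠ 0) :
    Z.card ≤ signVar (σL * (L.map (fun t : ℝ × ℤ × ℤ =>
        t.1 * (((a + b) / 2) ^ t.2.1 * ((a + b) / 2 - a) ^ t.2.2))).sum
      :: (([] : List (ℤ × ℝ)).map Prod.snd ++ [σH * (H.map (fun t : ℝ × ℤ × ℤ =>
        t.1 * (((a + b) / 2) ^ t.2.1 * (b - (a + b) / 2) ^ t.2.2))).sum])) := by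
  have hc : (a + b) / 2 ∈ Ioo a b := ⟨by linarith, by linarith⟩
  have hc0 : 0 < (a + b) / 2 := by linarith
  simp only [List.map_nil, List.sum_nil, add_zero, List.nil_append] at hZ hwit ⊢
  set A := σL * (L.map (fun t : ℝ × ℤ × ℤ => t.1 * (((a + b) / 2) ^ t.2.1 * ((a + b) / 2 - a) ^ t.2.2))).sum
    with hA
  set C := σH * (H.map (fun t : ℝ × ℤ × ℤ => t.1 * (((a + b) / 2) ^ t.2.1 * (b - (a + b) / 2) ^ t.2.2))).sum
    with hC
  have hLnn : ∀ t ∈ L, 0 ≤ t.1 := fun t ht => (hL t ht).1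
  have hHnn : ∀ t ∈ H, 0 ≤ t.1 := fun t ht => (hH t ht).1
  by_cases hAC : A * C < 0
  · -- one sign change: a single Euler step at `k = e + 1` leaves a zero-free function
    have hA0 : A ≠ 0 := fun h => by rw [h, zero_mul] at hAC; exact lt_irrefl _ hAC
    have hC0 : C ≠ 0 := fun h => by rw [h, mul_zero] at hAC; exact lt_irrefl _ hAC
    obtain ⟨L', H', hL'adm, hH'adm, hL'flag, hH'flag, hder⟩ :=
      euler_step a b ha e N σL σH L H hL hH (e + 1) (by omega) heN []
    simp only [List.map_nil, List.sum_nil, add_zero] at hder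
    obtain ⟨Z', hcard, hZ'⟩ := exists_finset_zeros_euler ha (e + 1) hder Z hZ
    -- the new function is zero-free
    have hσL : σL ≠ 0 := fun h => hA0 (by rw [hA, h, zero_mul])
    have hσH : σH ≠ 0 := fun h => hC0 (by rw [hC, h, zero_mul])
    have hflagL : ∃ t ∈ L, 0 < t.1 := by
      by_contra hno
      exact hA0 (by rw [hA, (lowEval_pos_or_zero a L hLnn).2 hno, mul_zero])
    have hflagH : ∃ t ∈ H, 0 < t.1 := by
      by_contra hno
      exact hC0 (by rw [hC, (highEval_pos_or_zero b H hHnn).2 hno, mul_zero])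
    have hELc := (lowEval_pos_or_zero a L hLnn).1 hflagL _ hc.1 hc0
    have hEHc := (highEval_pos_or_zero b H hHnn).1 hflagH _ hc.2 hc0
    have hσ : σL * σH < 0 := by
      rw [hA, hC] at hAC
      by_contra hge
      push Not at hge
      have : 0 ≤ σL * (L.map (fun t : ℝ × ℤ × ℤ =>
          t.1 * (((a + b) / 2) ^ t.2.1 * ((a + b) / 2 - a) ^ t.2.2))).sum *
          (σH * (H.map (fun t : ℝ × ℤ × ℤ => t.1 * (((a + b) / 2) ^ t.2.1 * (b - (a + b) / 2) ^ t.2.2))).sum) := by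
        have := mul_nonneg hge (mul_pos hELc hEHc).le
        linarith [this]
      linarith
    have hZ'e : Z' = ∅ := by
      by_contra hne
      obtain ⟨c', hc'⟩ := Finset.nonempty_iff_ne_empty.mpr hne
      obtain ⟨hc'I, hc'0⟩ := hZ' c' hc'
      have h1 := (lowEval_pos_or_zero a L' (fun t ht => (hL'adm t ht).1)).1 (hL'flag.mpr hflagL) c' hc'I.1
        (ha.trans hc'I.1)
      have h2 := ((highEval_pos_or_zero b H' (fun t ht => (hH'adm t ht).1)).1 (hH'flag.mpr hflagH) c' hc'I.2
        (ha.trans hc'I.1)).le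
      -- `−σL·(pos) + σH·(nonneg)` has the strict sign of `σH`
      rcases lt_or_gt_of_ne hσH with hσH' | hσH'
      · have : 0 < σL := by nlinarith
        nlinarith
      · have : σL < 0 := by nlinarith
        nlinarith
    rw [hZ'e, Finset.card_empty] at hcard
    rw [signVar_cons_cons_of_ne_zero hA0 hC0, if_pos hAC, signVar_single]
    omega
  · -- no sign change: `F` is zero-free
    have hZe : Z = ∅ := by
      by_contra hne
      obtain ⟨z, hz⟩ := Finset.nonempty_iff_ne_empty.mpr hne
      obtain ⟨hzI, hz0⟩ := hZ z hz
      obtain ⟨x₀, hx₀I, hx₀⟩ := hwit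
      obtain ⟨t₁, ht₁, e₁⟩ := lowEval_posMul a ha σL L hLnn hzI.1 hc.1
      obtain ⟨t₂, ht₂, e₂⟩ := highEval_posMul b σH H hHnn hzI.2 (ha.trans hzI.1) hc.2 hc0
      obtain ⟨s₁, hs₁, f₁⟩ := lowEval_posMul a ha σL L hLnn hx₀I.1 hc.1
      obtain ⟨s₂, hs₂, f₂⟩ := highEval_posMul b σH H hHnn hx₀I.2 (ha.trans hx₀I.1) hc.2 hc0
      rw [e₁, e₂, ← hA, ← hC] at hz0
      rw [f₁, f₂, ← hA, ← hC] at hx₀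
      have hAC' : 0 ≤ A * C := not_lt.mp hAC
      have hor : A ≠ 0 ∨ C ≠ 0 := by
        by_contra hno; push Not at hno; exact hx₀ (by rw [hno.1, hno.2]; ring)
      rcases lt_trichotomy A 0 with hAneg | hAz | hApos
      · have hCle : C ≤ 0 := by nlinarith
        nlinarith
      · rw [hAz] at hz0 hor
        have hCne : C ≠ 0 := hor.resolve_left (fun h => h rfl)
        have : t₂ * C = 0 := by linarith
        exact hCne ((mul_eq_zero.mp this).resolve_left ht₂.ne')
      · have hCge : 0 ≤ C := by nlinarith
        nlinarith
    rw [hZe, Finset.card_empty]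
    exact Nat.zero_le _

/-- **Step, single window term and no sign change at the head** (`W = [(k,g)]`, `σ_L·L(c)·g ≥ 0`): at most
`Var(σ_L·L(c), g, σ_H·H(c))` zeros. [folklore] -/
theorem card_le_signVar_window_single (a b : ℝ) (ha : 0 < a) (hab : a < b)
    (e N : ℤ) (σL σH : ℝ) (L H : List (ℝ × ℤ × ℤ)) (k : ℤ) (g : ℝ) 
    (_heN : e + 1 < N)
    (hL : ∀ t ∈ L, 0 ≤ t.1 ∧ t.2.1 + t.2.2 ≤ e ∧ t.2.2 ≤ 0) (hH : ∀ t ∈ H, 0 ≤ t.1 ∧ N ≤ t.2.1 ∧ t.2.2 ≤ 0)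
    (hkb : e < k ∧ k < N) (_hkW₀ : ∀ q' ∈ ([] : List (ℤ × ℝ)), k < q'.1) (_hW₀pw : (([] : List (ℤ × ℝ))).Pairwise (fun p q => p.1 < q.1))
    (_hW₀bd : ∀ q' ∈ ([] : List (ℤ × ℝ)), e < q'.1 ∧ q'.1 < N) (Z : Finset ℝ)
    (hZ : ∀ z ∈ Z, z ∈ Ioo a b ∧
      σL * (L.map (fun t : ℝ × ℤ × ℤ => t.1 * (z ^ t.2.1 * (z - a) ^ t.2.2))).sum
        + (((k, g) :: ([] : List (ℤ × ℝ))).map (fun p : ℤ × ℝ => p.2 * z ^ p.1)).sum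
        + σH * (H.map (fun t : ℝ × ℤ × ℤ => t.1 * (z ^ t.2.1 * (b - z) ^ t.2.2))).sum = 0)
    (hwit : ∃ x ∈ Ioo a b,
      σL * (L.map (fun t : ℝ × ℤ × ℤ => t.1 * (x ^ t.2.1 * (x - a) ^ t.2.2))).sum
        + (((k, g) :: ([] : List (ℤ × ℝ))).map (fun p : ℤ × ℝ => p.2 * x ^ p.1)).sum
        + σH * (H.map (fun t : ℝ × ℤ × ℤ => t.1 * (x ^ t.2.1 * (b - x) ^ t.2.2))).sum ≠ 0)
    (hAg : ¬ σL * (L.map (fun t : ℝ × ℤ × ℤ =>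
        t.1 * (((a + b) / 2) ^ t.2.1 * ((a + b) / 2 - a) ^ t.2.2))).sum * g < 0) :
    Z.card ≤ signVar (σL * (L.map (fun t : ℝ × ℤ × ℤ =>
        t.1 * (((a + b) / 2) ^ t.2.1 * ((a + b) / 2 - a) ^ t.2.2))).sum
      :: g :: ((([] : List (ℤ × ℝ))).map Prod.snd ++ [σH * (H.map (fun t : ℝ × ℤ × ℤ =>
        t.1 * (((a + b) / 2) ^ t.2.1 * (b - (a + b) / 2) ^ t.2.2))).sum])) := by
  have hc : (a + b) / 2 ∈ Ioo a b := ⟨by linarith, by linarith⟩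
  have hc0 : 0 < (a + b) / 2 := by linarith
  have hLnn : ∀ t ∈ L, 0 ≤ t.1 := fun t ht => (hL t ht).1
  have hHnn : ∀ t ∈ H, 0 ≤ t.1 := fun t ht => (hH t ht).1
  set A := σL * (L.map (fun t : ℝ × ℤ × ℤ => t.1 * (((a + b) / 2) ^ t.2.1 * ((a + b) / 2 - a) ^ t.2.2))).sum
    with hA
  set C := σH * (H.map (fun t : ℝ × ℤ × ℤ => t.1 * (((a + b) / 2) ^ t.2.1 * (b - (a + b) / 2) ^ t.2.2))).sum
    with hC
  have hELpos : (∃ t ∈ L, 0 < t.1) → ∀ x, a < x → 0 < (L.map (fun t : ℝ × ℤ × ℤ =>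
      t.1 * (x ^ t.2.1 * (x - a) ^ t.2.2))).sum := fun hf x hx => (lowEval_pos_or_zero a L hLnn).1 hf x hx (ha.trans hx)
  have hELzero : (¬ ∃ t ∈ L, 0 < t.1) → ∀ x, (L.map (fun t : ℝ × ℤ × ℤ =>
      t.1 * (x ^ t.2.1 * (x - a) ^ t.2.2))).sum = 0 := (lowEval_pos_or_zero a L hLnn).2
  have hEHpos : (∃ t ∈ H, 0 < t.1) → ∀ x, a < x → x < b → 0 < (H.map (fun t : ℝ × ℤ × ℤ =>
      t.1 * (x ^ t.2.1 * (b - x) ^ t.2.2))).sum :=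
    fun hf x hx hxb => (highEval_pos_or_zero b H hHnn).1 hf x hxb (ha.trans hx)
  have hEHzero : (¬ ∃ t ∈ H, 0 < t.1) → ∀ x, (H.map (fun t : ℝ × ℤ × ℤ =>
      t.1 * (x ^ t.2.1 * (b - x) ^ t.2.2))).sum = 0 := (highEval_pos_or_zero b H hHnn).2
  have hAg' : 0 ≤ A * g := not_lt.mp hAg
  ------------------------------------------------------------ a single window term: `[A, g, C]`
  simp only [List.map_cons, List.map_nil, List.nil_append, List.sum_cons, List.sum_nil, add_zero] at hZ hwit ⊢
  by_cases hop : A * C < 0 ∨ g * C < 0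
  · -- one Euler step at `k` leaves a zero-free function
    obtain ⟨L', H', hL'adm, hH'adm, hL'flag, hH'flag, hder⟩ :=
      euler_step a b ha e N σL σH L H hL hH k hkb.1 hkb.2 [(k, g)]
    have hder' : ∀ x ∈ Ioo a b, HasDerivAt
        (fun y : ℝ => y ^ (-k) * (σL * (L.map (fun t : ℝ × ℤ × ℤ => t.1 * (y ^ t.2.1 * (y - a) ^ t.2.2))).sum
          + g * y ^ k
          + σH * (H.map (fun t : ℝ × ℤ × ℤ => t.1 * (y ^ t.2.1 * (b - y) ^ t.2.2))).sum))
        (x ^ (-k - 1) * ((-σL) * (L'.map (fun t : ℝ × ℤ × ℤ => t.1 * (x ^ t.2.1 * (x - a) ^ t.2.2))).sum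
          + 0
          + σH * (H'.map (fun t : ℝ × ℤ × ℤ => t.1 * (x ^ t.2.1 * (b - x) ^ t.2.2))).sum)) x := by
      intro x hx
      have := hder x hx
      simp only [List.map_cons, List.map_nil, List.sum_cons, List.sum_nil, add_zero, sub_self, zero_mul] at this
      simpa only [add_zero] using this
    obtain ⟨Z', hcard, hZ'⟩ := exists_finset_zeros_euler ha k hder' Z hZ
    have hC_of : C ≠ 0 → (σH ≠ 0 ∧ ∃ t ∈ H, 0 < t.1) := by
      intro hC0
      refine ⟨fun h => hC0 (by rw [hC, h, zero_mul]), ?_⟩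
      by_contra hno; exact hC0 (by rw [hC, hEHzero hno, mul_zero])
    have hZ'e : Z' = ∅ := by
      by_contra hne
      obtain ⟨c', hc'⟩ := Finset.nonempty_iff_ne_empty.mpr hne
      obtain ⟨hc'I, hc'0⟩ := hZ' c' hc'
      rw [add_zero] at hc'0
      by_cases hA0 : A = 0
      · -- low parts vanish; the high part is strictly signed
        have hL'z : σL * (L'.map (fun t : ℝ × ℤ × ℤ => t.1 * (c' ^ t.2.1 * (c' - a) ^ t.2.2))).sum = 0 := by
          rcases mul_eq_zero.mp (hA.symm.trans hA0) with h | h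
          · rw [h, zero_mul]
          · have hno : ¬ ∃ t ∈ L, 0 < t.1 := fun hf => (hELpos hf _ hc.1).ne' h
            rw [(lowEval_pos_or_zero a L' (fun t ht => (hL'adm t ht).1)).2 (fun hf => hno (hL'flag.mp hf)) c',
              mul_zero]
        have hgC : g * C < 0 := by
          rcases hop with h | h
          · rw [hA0, zero_mul] at h; exact absurd h (lt_irrefl 0)
          · exact h
        have hC0 : C ≠ 0 := fun h => by rw [h, mul_zero] at hgC; exact lt_irrefl _ hgC
        obtain ⟨hσH, hfH⟩ := hC_of hC0
        have hpos := (highEval_pos_or_zero b H' (fun t ht => (hH'adm t ht).1)).1 (hH'flag.mpr hfH) c' hc'I.2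
          (ha.trans hc'I.1)
        have : (-σL) * (L'.map (fun t : ℝ × ℤ × ℤ => t.1 * (c' ^ t.2.1 * (c' - a) ^ t.2.2))).sum = 0 := by
          rw [neg_mul, hL'z, neg_zero]
        rw [this, zero_add] at hc'0
        exact (mul_ne_zero hσH hpos.ne') hc'0
      · have hσL : σL ≠ 0 := fun h => hA0 (by rw [hA, h, zero_mul])
        have hflagL : ∃ t ∈ L, 0 < t.1 := by
          by_contra hno; exact hA0 (by rw [hA, hELzero hno, mul_zero])
        have hELc := hELpos hflagL _ hc.1
        have hAC : A * C < 0 := by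
          rcases hop with h | h
          · exact h
          · by_cases hg0 : g = 0
            · rw [hg0, zero_mul] at h; exact absurd h (lt_irrefl 0)
            · have hAgpos : 0 < A * g := lt_of_le_of_ne hAg' (Ne.symm (mul_ne_zero hA0 hg0))
              nlinarith [mul_pos hAgpos (neg_pos.mpr h), sq_nonneg g, mul_self_pos.mpr hg0]
        have hC0 : C ≠ 0 := fun h => by rw [h, mul_zero] at hAC; exact lt_irrefl _ hAC
        obtain ⟨hσH, hfH⟩ := hC_of hC0
        have hEHc := hEHpos hfH _ hc.1 hc.2
        have h1 := (lowEval_pos_or_zero a L' (fun t ht => (hL'adm t ht).1)).1 (hL'flag.mpr hflagL) c' hc'I.1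
          (ha.trans hc'I.1)
        have h2 := (highEval_pos_or_zero b H' (fun t ht => (hH'adm t ht).1)).1 (hH'flag.mpr hfH) c' hc'I.2
          (ha.trans hc'I.1)
        have hσ : σL * σH < 0 := by
          rw [hA, hC] at hAC
          have : σL * (L.map (fun t : ℝ × ℤ × ℤ =>
              t.1 * (((a + b) / 2) ^ t.2.1 * ((a + b) / 2 - a) ^ t.2.2))).sum *
              (σH * (H.map (fun t : ℝ × ℤ × ℤ => t.1 * (((a + b) / 2) ^ t.2.1 * (b - (a + b) / 2) ^ t.2.2))).sum)
              = (σL * σH) * ((L.map (fun t : ℝ × ℤ × ℤ =>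
                t.1 * (((a + b) / 2) ^ t.2.1 * ((a + b) / 2 - a) ^ t.2.2))).sum *
                (H.map (fun t : ℝ × ℤ × ℤ => t.1 * (((a + b) / 2) ^ t.2.1 * (b - (a + b) / 2) ^ t.2.2))).sum) := by
            ring
          rw [this] at hAC
          by_contra hge; push Not at hge
          have := mul_nonneg hge (mul_pos hELc hEHc).le
          linarith
        rcases lt_or_gt_of_ne hσH with hs | hs
        · have : 0 < σL := by nlinarith
          nlinarith
        · have : σL < 0 := by nlinarith
          nlinarith
    rw [hZ'e, Finset.card_empty] at hcard
    -- the sign list `[A, g, C]` has at least one variation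
    have hsv : 1 ≤ signVar [A, g, C] := by
      by_cases hA0 : A = 0
      · have hgC : g * C < 0 := by
          rcases hop with h | h
          · rw [hA0, zero_mul] at h; exact absurd h (lt_irrefl 0)
          · exact h
        have hg0 : g ≠ 0 := fun h => by rw [h, zero_mul] at hgC; exact lt_irrefl _ hgC
        have hC0 : C ≠ 0 := fun h => by rw [h, mul_zero] at hgC; exact lt_irrefl _ hgC
        rw [hA0, signVar_zero_cons, signVar_cons_cons_of_ne_zero hg0 hC0, if_pos hgC, signVar_single]
      · by_cases hg0 : g = 0
        · have hAC : A * C < 0 := by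
            rcases hop with h | h
            · exact h
            · rw [hg0, zero_mul] at h; exact absurd h (lt_irrefl 0)
          have hC0 : C ≠ 0 := fun h => by rw [h, mul_zero] at hAC; exact lt_irrefl _ hAC
          rw [hg0, signVar_cons_zero_cons, signVar_cons_cons_of_ne_zero hA0 hC0, if_pos hAC, signVar_single]
        · have hAgpos : 0 < A * g := lt_of_le_of_ne hAg' (Ne.symm (mul_ne_zero hA0 hg0))
          have hgC : g * C < 0 := by
            rcases hop with h | h
            · nlinarith [mul_pos hAgpos (neg_pos.mpr h), sq_nonneg A, mul_self_pos.mpr hA0]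
            · exact h
          have hC0 : C ≠ 0 := fun h => by rw [h, mul_zero] at hgC; exact lt_irrefl _ hgC
          rw [signVar_cons_cons_of_ne_zero hA0 hg0, if_neg hAg, signVar_cons_cons_of_ne_zero hg0 hC0, if_pos hgC, signVar_single]
    omega
  · -- no opposition at all: zero-free
    push Not at hop
    obtain ⟨hAC, hgC⟩ := hop
    have hsigns : (0 ≤ A ∧ 0 ≤ g ∧ 0 ≤ C) ∨ (A ≤ 0 ∧ g ≤ 0 ∧ C ≤ 0) := by
      rcases lt_trichotomy A 0 with h | h | h
      · right; exact ⟨h.le, by nlinarith, by nlinarith⟩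
      · rcases lt_trichotomy g 0 with h' | h' | h'
        · right; exact ⟨h.le, h'.le, by nlinarith⟩
        · rcases le_total 0 C with h'' | h''
          · left; exact ⟨h.ge, h'.ge, h''⟩
          · right; exact ⟨h.le, h'.le, h''⟩
        · left; exact ⟨h.ge, h'.le, by nlinarith⟩
      · left; exact ⟨h.le, by nlinarith, by nlinarith⟩
    have key : ∀ y ∈ Ioo a b,
        σL * (L.map (fun t : ℝ × ℤ × ℤ => t.1 * (y ^ t.2.1 * (y - a) ^ t.2.2))).sum + g * y ^ k
          + σH * (H.map (fun t : ℝ × ℤ × ℤ => t.1 * (y ^ t.2.1 * (b - y) ^ t.2.2))).sum = 0 →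
        A = 0 ∧ g = 0 ∧ C = 0 := by
      intro y hyI hy
      obtain ⟨t₁, ht₁, e₁⟩ := lowEval_posMul a ha σL L hLnn hyI.1 hc.1
      obtain ⟨t₂, ht₂, e₂⟩ := highEval_posMul b σH H hHnn hyI.2 (ha.trans hyI.1) hc.2 hc0
      rw [e₁, e₂, ← hA, ← hC] at hy
      have hyk : 0 < y ^ k := zpow_pos (ha.trans hyI.1) k
      rcases hsigns with ⟨h1, h2, h3⟩ | ⟨h1, h2, h3⟩
      · have p1 : 0 ≤ t₁ * A := mul_nonneg ht₁.le h1
        have p2 : 0 ≤ g * y ^ k := mul_nonneg h2 hyk.le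
        have p3 : 0 ≤ t₂ * C := mul_nonneg ht₂.le h3
        have q1 : t₁ * A = 0 := by linarith
        have q2 : g * y ^ k = 0 := by linarith
        have q3 : t₂ * C = 0 := by linarith
        exact ⟨(mul_eq_zero.mp q1).resolve_left ht₁.ne', (mul_eq_zero.mp q2).resolve_right hyk.ne',
          (mul_eq_zero.mp q3).resolve_left ht₂.ne'⟩
      · have p1 : t₁ * A ≤ 0 := mul_nonpos_of_nonneg_of_nonpos ht₁.le h1
        have p2 : g * y ^ k ≤ 0 := mul_nonpos_of_nonpos_of_nonneg h2 hyk.le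
        have p3 : t₂ * C ≤ 0 := mul_nonpos_of_nonneg_of_nonpos ht₂.le h3
        have q1 : t₁ * A = 0 := by linarith
        have q2 : g * y ^ k = 0 := by linarith
        have q3 : t₂ * C = 0 := by linarith
        exact ⟨(mul_eq_zero.mp q1).resolve_left ht₁.ne', (mul_eq_zero.mp q2).resolve_right hyk.ne',
          (mul_eq_zero.mp q3).resolve_left ht₂.ne'⟩
    have hZe : Z = ∅ := by
      by_contra hne
      obtain ⟨z, hz⟩ := Finset.nonempty_iff_ne_empty.mpr hne
      obtain ⟨hzI, hz0⟩ := hZ z hz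
      obtain ⟨hA0, hg0, hC0⟩ := key z hzI hz0
      obtain ⟨x₀, hx₀I, hx₀⟩ := hwit
      obtain ⟨s₁, hs₁, f₁⟩ := lowEval_posMul a ha σL L hLnn hx₀I.1 hc.1
      obtain ⟨s₂, hs₂, f₂⟩ := highEval_posMul b σH H hHnn hx₀I.2 (ha.trans hx₀I.1) hc.2 hc0
      rw [f₁, f₂, ← hA, ← hC, hA0, hg0, hC0] at hx₀
      exact hx₀ (by ring)
    rw [hZe, Finset.card_empty]
    exact Nat.zero_le _


end Summit.ValiantsHypothesis.ValiantsHypothesis.Theorems.KPlusLogSqLaw.LocalDescartes
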